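import Summits.QuantumFields.YangMills.Theorems.BalabanUVNodesK0Gauge152FluxFloor
import Literature.MathematicalPhysics.QuantumFieldTheory.Balaban1983to89.Node00.TorusCoverGaugeTokensR

/-!
# K0⁷ ROW P11 — THE UNIFORM-FLUX FLOOR OF dag-n07-e's FLOOR-CARRYING GAUGE-FIXING SENTENCE `Gauge152OfClassTopStepR F N Sup M c B₉ a₀ → F.L · M ≤ 26 · B₉` (EVERY floor `c`),
# and its reading on the K0 road's N05 input: [6] Prop. 6 AT NODE 00's ℤᵈ MEMBER forces `0 < B₁` (indeed `L·M ≤ 26·b9Of F M B₁` at every cube letter `M ≥ 1`)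

Cell `pub-ymgap`, seat `pub-ymgap-dag-n21-c` g11 (K0 ROW P11 negative lane of record; trigger (t32) of g10's list: n07-e's R-twins LANDED, FILE 29 p546637).  FILE D.
`--kind proof --supports stmt-QuantumFields-20541 --as helper`.  [15] = [Balaban1985Variational], [6] = [Balaban1985RegularSpaces], [I] = [Balaban1987RG1].

WHY.  FILE 25C (`K0Gauge152FluxFloor`, p544138) proved `Gauge152OfClassTopStep F N Sup M B₉ a₀ → F.L·M ≤ 26·B₉` by the uniform-flux instance at the record's default numerics
(`M₁ = 1`).  n07-e's R-twin carries ONE more binder `c ≤ ν.M₁`; the instance is numerics-blind except for `exists_seq_top (ν)` (the TOP index exists and is separated for EVERY `ν`)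
and the selector `Sup ν K Ω` (irrelevant: the uniform-flux configuration is in the class on the whole torus), so the SAME instance at the numerics `{numerics7OfRecord₁₂ with M₁ := max c 1}`
meets the floor for every `c`: the flux floor survives the R-port verbatim.  Composed with n07-e's `gauge152R_of_prop6` (`Gauge152OfClassTopStepR … M ((11·4+3L)L) (b9Of F M B₁) (a0Of …)`
from [6] Prop. 6 at NODE 00's member, `b9Of F M B₁ = 112·L⁵·B₁·(LM + 44 + L) + 1`): the member sentence `B8.Prop6Printed 4 L B₁ c₁ (zdCub (MatA N) L ·)` (plan V14 stub 2's body, with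
`0 ≤ B₁`, `0 < c₁`) forces `L·M ≤ 26·b9Of F M B₁` for every `M ≥ 1`, hence `0 < B₁` (at `M = 3`: `39 ≤ 26·(112L⁵B₁(4L+44)) + 26`) — stub 2 has NO witness with `B₁ = 0`
(print: «positive constants B₁»; n05-e's road has `B₁ = 5dLB₀ ≥ 2` — consistent; a letter, not a defect).

CONTENTS (theorems only).  ★ `dist1_pow_sq_le_of_gauge152OfClassTopStepR` (FILE 25C's instance half at the floor-carrying numerics) · ★★ `sq_L_mul_sub_one_le_of_gauge152OfClassTopStepR` ·
★★ `L_mul_le_of_gauge152OfClassTopStepR : Gauge152OfClassTopStepR F N Sup M c B₉ a₀ → F.L·M ≤ 26·B₉` · `not_gauge152OfClassTopStepR_of_lt` · ★★ `L_mul_le_b9Of_of_prop6Member`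
(`B8.Prop6Printed 4 L B₁ c₁ (zdCub (MatA N) L ·) → ∀ M ≥ 1, F.L·M ≤ 26·b9Of F M B₁`) · ★★ `pos_of_prop6Member : … → 0 < B₁` · `not_prop6Member_zero` (`B₁ = 0` refuted BY VALUE).

HONEST FRAMING: kernel floors on TREE-typed named facts (`Prop`s with parameters, never asserted); nothing of Bałaban asserted or refuted; stub 2 ∕ K0⁷ neither discharged nor
refuted; N21 NOT discharged; counts unmoved (typed 28∕28 · discharged 5∕27); one finite `𝕋⁴` torus family at fixed `ε = L^{−K}`; not continuum ∕ OS ∕ mass gap ∕ Clay.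
THEOREMS ONLY: no `def`, `instance`, `notation`, `sorry`; standard axioms; default heartbeats.
-/

noncomputable section

open scoped Matrix.Norms.L2Operator

namespace Summit.QuantumFields.YangMills.Theorems.K0Gauge152RFluxFloor

open Literature.MathematicalPhysics.QuantumFieldTheory.Balaban1983to89
open Literature.MathematicalPhysics.QuantumFieldTheory.Balaban1983to89.Node00
open Literature.MathematicalPhysics.QuantumFieldTheory.Balaban1983to89.T4Continuum
open B15Eq112TorusCover B14DomainGeom B15DeterminingSets B12RegularSpaces111
open Summit.QuantumFields.YangMills.Theorems.K0BgProvisoOverRange (shift_cover)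
open Summit.QuantumFields.YangMills.Theorems.K0TopIndexWrapGeometry (exists_seq_top zero_mem_cubeIndices)
open Summit.QuantumFields.YangMills.Theorems.K0VariationalThm1GaugeWrap (norm_expI_sub_one_le eta_nonneg_le_one)
open Summit.QuantumFields.YangMills.Theorems.K0UniformFluxConfig
open Summit.QuantumFields.YangMills.Theorems.K0Gauge152FluxGeometry
open Summit.QuantumFields.YangMills.Theorems.K0Gauge152FluxFloor (exists_flux_scale)

section Floor

variable {F : T4Family} {N : ℕ} [NeZero N]

/-- **THE HANDED-OVER GAUGE READS THE SQUARE'S FLUX, AT THE FLOOR-CARRYING NUMERICS** — FILE 25C's `dist1_pow_sq_le_of_gauge152OfClassTopStep` VERBATIM except that the sentence is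
n07-e's R-twin and it is applied at the numerics `νc := {numerics7OfRecord₁₂ with M₁ := max c 1}` (so `0 < νc.M₁` and `c ≤ νc.M₁`); the TOP index exists for every `ν`
(`exists_seq_top`) and the uniform-flux configuration is in the class on the whole torus (selector-blind). [cite: Balaban1985Variational, (144)–(153) pp.300–301; Balaban1985RegularSpaces, Thm 2 pp.82–83, (1.3)–(1.9) p.77; Balaban1987RG1, (1.12) p.262] -/
theorem dist1_pow_sq_le_of_gauge152OfClassTopStepR (hN : 2 ≤ N) {Sup : (ν : Stage7Numerics) → (K : ℕ) → (ℕ → Set (Site (F.P K) 0)) → Set (Site (F.P K) 0)}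
    {M c : ℕ} (hM : 1 ≤ M) {B₉ a₀ : ℝ} (h : Gauge152OfClassTopStepR F N Sup M c B₉ a₀) (K : ℕ) {ε : ℝ} (hεpos : 0 < ε) (hεa₀ : ε ≤ a₀)
    (hBε : max B₉ 1 * ε ≤ 1) (hSP : F.L ^ 2 * M < (F.P K).sitesPerDir 0) {D : SU N} (hDP : D ^ (F.P K).sitesPerDir 0 = 1)
    (hdistD : dist1 D < ε / (F.L : ℝ) ^ 2) :
    0 < B₉ ∧ dist1 (D ^ ((F.L ^ 2 * M - 1) * (F.L ^ 2 * M - 1))) ≤ ((4 * (F.L ^ 2 * M - 1) : ℕ) : ℝ) * (2 * ((F.P K).eta 1 * (B₉ * ε))) := by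
  classical
  have _hN := hN
  set P : Params := F.P K with hPdef
  have hPd : P.d = 4 := T4Family.P_d F K
  have hPL : P.L = F.L := T4Family.P_L F K
  have hL13 : 13 ≤ F.L := by obtain ⟨hodd, _⟩ := F.hL; have := F.hL11; rcases hodd with ⟨r, hr⟩; omega
  set S : ℕ := F.L ^ 2 * M with hSdef
  have hS : 169 ≤ S := by rw [hSdef]; nlinarith [hL13, hM]
  set s : ℕ := S - 1 with hsdef
  have hsS : s + 1 ≤ S := by omega
  have hsPer : s < P.sitesPerDir 0 := by omega
  -- the uniform-flux configuration
  set μ₁ : Fin P.d := ⟨0, by rw [hPd]; norm_num⟩ with hμ₁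
  set μ₂ : Fin P.d := ⟨1, by rw [hPd]; norm_num⟩ with hμ₂
  have h12 : μ₁ < μ₂ := Fin.mk_lt_mk.2 (by norm_num)
  have hne : μ₁ ≠ μ₂ := ne_of_lt h12
  set U : GaugeField P 0 (SU N) := fun b => if b.dir = μ₂ then D ^ (b.src μ₁).val else 1 with hUdef
  have hU : ∀ b, U b = if b.dir = μ₂ then D ^ (b.src μ₁).val else 1 := fun _ => rfl
  -- class (2)/(6)-Top at thresholds `ε_m ≡ ε`
  have hLpos : (0 : ℝ) < F.L := by exact_mod_cast (show 0 < F.L by omega)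
  have hη1 : P.eta 1 = ((F.L : ℝ))⁻¹ := by rw [Params.eta, hPL, pow_one]
  have hη : ∀ m, m ≤ 1 → ε / (F.L : ℝ) ^ 2 ≤ ε * P.eta m ^ 2 := by
    intro m hm
    rcases Nat.le_one_iff_eq_zero_or_eq_one.1 hm with rfl | rfl
    · rw [Params.eta, pow_zero, one_pow, mul_one]
      have hL1 : (1 : ℝ) ≤ F.L := by exact_mod_cast (show 1 ≤ F.L by omega)
      exact div_le_self hεpos.le (by nlinarith)
    · rw [hη1, inv_pow, div_eq_mul_inv]
  have hηpos : ∀ m, 0 < P.eta m := fun m => by rw [Params.eta, hPL]; positivity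
  -- the numerics carrying the floor: the record's defaults with `M₁ := max c 1`
  set νc : Stage7Numerics := { numerics7OfRecord₁₂ with M₁ := max c 1 } with hνc
  have hM₁c : 0 < νc.M₁ := lt_of_lt_of_le Nat.one_pos (le_max_right c 1)
  have hcνc : c ≤ νc.M₁ := le_max_left c 1
  obtain ⟨sq, hΩ, hsep⟩ := exists_seq_top F νc hM (fun _ => (1 : ℝ)) K 1
  have hplaq : ∀ m, m ≤ 1 → PlaqSmallOn (Sect2.omegaPlaqsTop sq.Ω (Sup νc K sq.Ω) m) (ε * P.eta m ^ 2) U :=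
    fun m hm q _ => ((dist1_plaqHol_flux_le h12 hDP hU q).trans_lt hdistD).trans_le (hη m hm)
  have hcodiv : ∀ m, m ≤ 1 → Sect2.CoDivSmallOn (Sect2.omegaBondsTop sq.Ω (Sup νc K sq.Ω) m) (ε * P.eta m ^ 3) U :=
    fun m _ => coDivSmallOn_flux h12 hDP hU _ (mul_pos hεpos (pow_pos (hηpos m) 3))
  -- the [I]-cube of step 1, index 0: side `S = L²M`, non-wrapping, inside `Ω₁ = T_η`
  have hside : B14.Eq213MaximalDomains.side P.L M (1 + 1) = S := by rw [B14.Eq213MaximalDomains.side, hPL, hSdef]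
  have hSN : ((B14.Eq213MaximalDomains.side P.L M (1 + 1) : ℕ) : ℤ) < P.sitesPerDir 0 := by rw [hside]; exact_mod_cast hSP
  have hS0 : 0 < B14.Eq213MaximalDomains.side P.L M (1 + 1) := by rw [hside]; omega
  have hcube : cubeEnl P (B14.Eq213MaximalDomains.side P.L M (1 + 1)) 0 0 ⊆ sq.Ω 1 := by rw [hΩ 1 le_rfl le_rfl]; exact Set.subset_univ _
  -- apply the sentence
  obtain ⟨u, A, hgauge, hA, -⟩ := h νc (fun _ => (1 : ℝ)) K 1 sq hsep hM₁c hcνc le_rfl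
    (fun _ => ε) (fun _ _ => ⟨hεpos, hεa₀⟩) (fun _ _ => by linarith) (fun _ _ => by linarith) U hplaq hcodiv 1 le_rfl le_rfl _ (Or.inr rfl) hSN 0
    (zero_mem_cubeIndices hS0) hcube
  rw [hside] at hgauge hA
  -- `0 < B₉` from the bond `⟨π(0), e₀⟩` of the cube
  have hb0 : (⟨cover P 0, μ₁⟩ : PBond P 0) ∈ (Sect2.regionOfSet P (cubeEnl P S 0 0)).bonds := by
    refine ⟨cover_mem_cubeEnl_zero_of_box fun κ => by simp; omega, ?_⟩
    show (cover P 0).shift μ₁ ∈ _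
    rw [shift_cover]
    exact cover_mem_cubeEnl_zero_of_box fun κ => by
      by_cases hk : κ = μ₁
      · subst hk; simp; omega
      · simp [Function.update_of_ne hk]; omega
  have hB₉pos : 0 < B₉ := by
    have h1 := hA _ hb0
    have h0 := norm_nonneg (A ⟨cover P 0, μ₁⟩)
    by_contra hB; rw [not_lt] at hB
    have : B₉ * ε ≤ 0 := mul_nonpos_of_nonpos_of_nonneg hB hεpos.le
    linarith
  have hB₉ε : B₉ * ε ≤ 1 := le_trans (mul_le_mul_of_nonneg_right (le_max_left _ _) hεpos.le) hBε
  -- per-bond estimate in the handed-over gauge along the square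
  obtain ⟨hη0, hη1le⟩ := eta_nonneg_le_one P 1
  have hbonds := bonds_rectWord_subset (P := P) hne (s := s) (S := S) hsS
  have hstep : ∀ st ∈ walk (cover P 0) (T4ReflectionCone.rectWord μ₁ μ₂ s s), dist1 (GaugeField.gaugeAct u U st.bond) ≤ 2 * (P.eta 1 * (B₉ * ε)) := by
    intro st hst
    have hb := hbonds st hst
    have h1 := hgauge _ hb
    rw [gaugeU_ιSU] at h1
    rw [dist1_su_eq_norm, ← coe_ιSU, h1]
    have hAb := (hA _ hb).le
    have hAt : P.eta 1 * ‖A st.bond‖ ≤ 1 :=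
      calc P.eta 1 * ‖A st.bond‖ ≤ 1 * (B₉ * ε) := mul_le_mul hη1le hAb (norm_nonneg _) zero_le_one
        _ ≤ 1 := by rw [one_mul]; exact hB₉ε
    exact (norm_expI_sub_one_le hη0 hAt).trans (by gcongr)
  -- the two readings of the square's holonomy
  have hhol : holAt U (walk (cover P 0) (T4ReflectionCone.rectWord μ₁ μ₂ s s)) = D ^ (s * s) :=
    holAt_flux_rectWord h12 hU (by simp) hsPer
  have hclosed : walkEnd (cover P 0) (T4ReflectionCone.rectWord μ₁ μ₂ s s) = cover P 0 :=
    walkEnd_eq_self_of_netDisp fun ν => by rw [T4ReflectionCone.netDisp_rectWord, Int.cast_zero]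
  have hgaugehol : holAt (GaugeField.gaugeAct u U) (walk (cover P 0) (T4ReflectionCone.rectWord μ₁ μ₂ s s)) =
      u (cover P 0) * D ^ (s * s) * (u (cover P 0))⁻¹ := by
    rw [holAt_gaugeAct_walk, hhol, hclosed]
  have hlen : (walk (cover P 0) (T4ReflectionCone.rectWord μ₁ μ₂ s s)).length = 4 * s := by
    rw [length_walk]; simp [T4ReflectionCone.rectWord]; ring
  have h1 := dist1_holAt_le_length_mul (GaugeField.gaugeAct u U) _ hstep
  rw [hgaugehol, GaugeGroup.dist1_conj, hlen] at h1
  exact ⟨hB₉pos, h1⟩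


/-- **★★ THE UNIFORM-FLUX FLOOR OF THE R-TWIN**: for every torus family `F`, `N ≥ 2`, selector `Sup`, cube letter `M ≥ 1`, floor `c` and `0 < a₀`, `Gauge152OfClassTopStepR F N Sup M c B₉ a₀`
forces `L²M − 1 ≤ 8π·L·B₉` (FILE 25C's argument at the floor-carrying numerics: Jordan below, the handed-over gauge above). [cite: Balaban1985Variational, Thm 1 (9) p.279, (144)–(153) pp.300–301; Balaban1985RegularSpaces, Thm 2 pp.82–83, (1.3)–(1.6) p.77; Balaban1987RG1, (1.12) p.262] -/
theorem sq_L_mul_sub_one_le_of_gauge152OfClassTopStepR (hN : 2 ≤ N) {Sup : (ν : Stage7Numerics) → (K : ℕ) → (ℕ → Set (Site (F.P K) 0)) → Set (Site (F.P K) 0)}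
    {M c : ℕ} (hM : 1 ≤ M) {B₉ a₀ : ℝ} (ha₀ : 0 < a₀) (h : Gauge152OfClassTopStepR F N Sup M c B₉ a₀) :
    ((F.L : ℝ) ^ 2 * M - 1) ≤ 8 * Real.pi * F.L * B₉ := by
  have hL13 : 13 ≤ F.L := by obtain ⟨hodd, _⟩ := F.hL; have := F.hL11; rcases hodd with ⟨r, hr⟩; omega
  have hLR : (13 : ℝ) ≤ F.L := by exact_mod_cast hL13
  have hLpos : (0 : ℝ) < F.L := by linarith
  have hπ := Real.pi_pos
  set S : ℕ := F.L ^ 2 * M with hSdef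
  have hS : 169 ≤ S := by rw [hSdef]; nlinarith [hL13, hM]
  set s : ℕ := S - 1 with hsdef
  have hsS : s + 1 = S := by omega
  have hs1 : 1 ≤ s := by omega
  have hsR : (s : ℝ) = (F.L : ℝ) ^ 2 * M - 1 := by
    have e : ((s + 1 : ℕ) : ℝ) = ((F.L ^ 2 * M : ℕ) : ℝ) := by rw [hsS]
    push_cast at e; linarith
  have hspos : (0 : ℝ) < s := by exact_mod_cast hs1
  -- the scales
  obtain ⟨K, j, ε, θ₀, hεpos, hεa₀, hβε, hSP, hθP, hθ₀pos, hθL, hθL', hsθ⟩ := exists_flux_scale F hM ha₀ (le_max_right B₉ 1)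
  have hsθ' : (s : ℝ) ^ 2 * θ₀ ≤ Real.pi := hsθ
  have hPerpos : 0 < (F.P K).sitesPerDir 0 := by omega
  have hPerR : (0 : ℝ) < (F.P K).sitesPerDir 0 := by exact_mod_cast hPerpos
  -- the diagonal `D = D_{θ₀}` with `D^P = 1` and `dist1 D < ε/L²`
  obtain ⟨D, hD⟩ := exists_su_diag (N := N) hN θ₀
  have hDP : D ^ (F.P K).sitesPerDir 0 = 1 := by
    apply eq_one_of_dist1_eq_zero
    rw [hD]
    have e : ((F.P K).sitesPerDir 0 : ℝ) * θ₀ / 2 = (j : ℕ) * Real.pi := by rw [mul_comm, hθP]; ring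
    rw [e, Real.sin_nat_mul_pi]; simp
  have hθ₀le : θ₀ ≤ ε / (F.L : ℝ) ^ 2 := by rw [le_div_iff₀ (by positivity)]; exact hθL
  have hdistD : dist1 D < ε / (F.L : ℝ) ^ 2 := by
    have h1 := hD 1
    rw [pow_one, Nat.cast_one, one_mul] at h1
    rw [h1]
    have hθπ : θ₀ / 2 ≤ Real.pi := by
      have : θ₀ ≤ Real.pi :=
        calc θ₀ = 1 * θ₀ := (one_mul _).symm
          _ ≤ (s : ℝ) ^ 2 * θ₀ := mul_le_mul_of_nonneg_right (by nlinarith [(show (1 : ℝ) ≤ s by exact_mod_cast hs1)]) hθ₀pos.le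
          _ ≤ Real.pi := hsθ'
      linarith
    have hsin0 : 0 ≤ Real.sin (θ₀ / 2) := Real.sin_nonneg_of_nonneg_of_le_pi (by linarith) hθπ
    have hsinlt : Real.sin (θ₀ / 2) < θ₀ / 2 := Real.sin_lt (by linarith)
    rw [Real.norm_eq_abs, abs_of_nonneg (by linarith)]
    linarith
  -- the instance half
  obtain ⟨hB₉pos, hupper⟩ := dist1_pow_sq_le_of_gauge152OfClassTopStepR hN hM h K hεpos hεa₀ hβε hSP hDP hdistD
  -- lower bound by Jordan's inequality
  have hlower : 2 / Real.pi * ((s : ℝ) ^ 2 * θ₀) ≤ dist1 (D ^ (s * s)) := by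
    rw [hD (s * s)]
    have hsq : ((s * s : ℕ) : ℝ) * θ₀ / 2 = (s : ℝ) ^ 2 * θ₀ / 2 := by push_cast; ring
    rw [hsq]
    have h0 : 0 ≤ (s : ℝ) ^ 2 * θ₀ / 2 := by positivity
    have hπ2 : (s : ℝ) ^ 2 * θ₀ / 2 ≤ Real.pi / 2 := by linarith [hsθ']
    have hj := Real.mul_le_sin h0 hπ2
    have hsin0 : 0 ≤ Real.sin ((s : ℝ) ^ 2 * θ₀ / 2) := le_trans (by positivity) hj
    rw [Real.norm_eq_abs, abs_of_nonneg (by linarith)]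
    linarith
  have hη1 : (F.P K).eta 1 = ((F.L : ℝ))⁻¹ := by rw [Params.eta, T4Family.P_L, pow_one]
  have hchain : 2 / Real.pi * ((s : ℝ) ^ 2 * (ε / (2 * (F.L : ℝ) ^ 2))) ≤ ((4 * s : ℕ) : ℝ) * (2 * (((F.L : ℝ))⁻¹ * (B₉ * ε))) := by
    rw [← hη1]
    have hθ₀ge : ε / (2 * (F.L : ℝ) ^ 2) ≤ θ₀ := by rw [div_le_iff₀ (by positivity)]; exact hθL'
    calc 2 / Real.pi * ((s : ℝ) ^ 2 * (ε / (2 * (F.L : ℝ) ^ 2))) ≤ 2 / Real.pi * ((s : ℝ) ^ 2 * θ₀) := by gcongr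
      _ ≤ dist1 (D ^ (s * s)) := hlower
      _ ≤ _ := hupper
  -- `s ≤ 8π L B₉`
  have hfinal : (s : ℝ) ≤ 8 * Real.pi * F.L * B₉ := by
    have hπ0 : Real.pi ≠ 0 := Real.pi_ne_zero
    have hL0 : (F.L : ℝ) ≠ 0 := ne_of_gt hLpos
    have e1 : Real.pi * (F.L : ℝ) ^ 2 * (2 / Real.pi * ((s : ℝ) ^ 2 * (ε / (2 * (F.L : ℝ) ^ 2)))) = (s : ℝ) ^ 2 * ε := by
      field_simp
    have e2 : Real.pi * (F.L : ℝ) ^ 2 * (((4 * s : ℕ) : ℝ) * (2 * (((F.L : ℝ))⁻¹ * (B₉ * ε)))) = 8 * Real.pi * F.L * B₉ * (s * ε) := by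
      push_cast; field_simp; ring
    have h1 := mul_le_mul_of_nonneg_left hchain (by positivity : (0 : ℝ) ≤ Real.pi * (F.L : ℝ) ^ 2)
    rw [e1, e2] at h1
    have hsε : 0 < (s : ℝ) * ε := by positivity
    by_contra hc
    rw [not_le] at hc
    nlinarith [h1, mul_pos hsε (sub_pos.2 hc)]
  linarith [hsR]


/-- **★★ CLEAN FORM: `Gauge152OfClassTopStepR F N Sup M c B₉ a₀ → F.L · M ≤ 26 · B₉`** (`N ≥ 2`, `M ≥ 1`, `0 < a₀`, every floor `c`). [cite: Balaban1985Variational, (152) p.301; Balaban1985RegularSpaces, Thm 2 pp.82–83, (1.3)–(1.6) p.77 (bookkeeping)] -/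
theorem L_mul_le_of_gauge152OfClassTopStepR (hN : 2 ≤ N) {Sup : (ν : Stage7Numerics) → (K : ℕ) → (ℕ → Set (Site (F.P K) 0)) → Set (Site (F.P K) 0)}
    {M c : ℕ} (hM : 1 ≤ M) {B₉ a₀ : ℝ} (ha₀ : 0 < a₀) (h : Gauge152OfClassTopStepR F N Sup M c B₉ a₀) : (F.L : ℝ) * M ≤ 26 * B₉ := by
  have h1 := sq_L_mul_sub_one_le_of_gauge152OfClassTopStepR hN hM ha₀ h
  have hL13 : 13 ≤ F.L := by obtain ⟨hodd, _⟩ := F.hL; have := F.hL11; rcases hodd with ⟨r, hr⟩; omega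
  have hLR : (13 : ℝ) ≤ F.L := by exact_mod_cast hL13
  have hMR : (1 : ℝ) ≤ M := by exact_mod_cast hM
  have hπ : Real.pi < 3.15 := Real.pi_lt_d2
  have hLpos : (0 : ℝ) < F.L := by linarith
  have hLM : (13 : ℝ) ≤ (F.L : ℝ) * M := by nlinarith
  have hLLM : (169 : ℝ) ≤ (F.L : ℝ) ^ 2 * M := by nlinarith
  have hB : 0 < B₉ := by
    by_contra hb
    rw [not_lt] at hb
    have : 8 * Real.pi * F.L * B₉ ≤ 0 := mul_nonpos_of_nonneg_of_nonpos (by positivity) hb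
    linarith
  have hLB : 0 < (F.L : ℝ) * B₉ := mul_pos hLpos hB
  have h25 : 8 * Real.pi * F.L * B₉ ≤ 25.2 * (F.L * B₉) := by nlinarith [hLB, hπ]
  by_contra hc
  rw [not_le] at hc
  have h2 : 26 * (F.L * B₉) < (F.L : ℝ) ^ 2 * M := by nlinarith [hc, hLpos]
  nlinarith [h1, h25, h2, hLLM, hLB]


/-- Hence `¬ Gauge152OfClassTopStepR F N Sup M c B₉ a₀` whenever `26·B₉ < F.L·M` (`N ≥ 2`, `M ≥ 1`, `0 < a₀`). [cite: Balaban1985Variational, (152) p.301 (bookkeeping)] -/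
theorem not_gauge152OfClassTopStepR_of_lt (hN : 2 ≤ N) {Sup : (ν : Stage7Numerics) → (K : ℕ) → (ℕ → Set (Site (F.P K) 0)) → Set (Site (F.P K) 0)}
    {M c : ℕ} (hM : 1 ≤ M) {B₉ a₀ : ℝ} (ha₀ : 0 < a₀) (hB : 26 * B₉ < (F.L : ℝ) * M) : ¬ Gauge152OfClassTopStepR F N Sup M c B₉ a₀ :=
  fun h => absurd (L_mul_le_of_gauge152OfClassTopStepR hN hM ha₀ h) (not_le.mpr hB)

end Floor

/-! ## §2  The reading on the K0 road's N05 input: [6] Prop. 6 at NODE 00's member forces `0 < B₁` -/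

section PropSixMember

variable {F : T4Family} {N : ℕ} [NeZero N]

/-- **★★ THE FLUX FLOOR OF [6] PROP. 6 AT NODE 00's ℤᵈ MEMBER**: the member sentence `B8.Prop6Printed 4 L B₁ c₁ (zdCub (MatA N) L ·)` over n05-a's whole index (plan V14 stub 2's body; `0 ≤ B₁`,
`0 < c₁`, `N ≥ 2`) forces `F.L·M ≤ 26·b9Of F M B₁` at EVERY cube letter `M ≥ 1` — n07-e's `gauge152R_of_prop6` (FILE 29: the member gives `Gauge152OfClassTopStepR … M ((11·4+3L)L) (b9Of F M B₁) (a0Of F N M B₁ c₁)`,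
`0 < a0Of`) composed with §1.  A LETTER on stub 2's constant (print-compatible: `b9Of ∝ L⁵·B₁·(LM + 44 + L)` grows with `M`). [cite: Balaban1985RegularSpaces, Prop. 6 (1.135)–(1.137) p.99; Balaban1985Variational, (152) p.301] -/
theorem L_mul_le_b9Of_of_prop6Member (hN : 2 ≤ N) {B₁ c₁ : ℝ} (hB₁ : 0 ≤ B₁) (hc₁ : 0 < c₁)
    (hP6 : letI : CStarAlgebra (MatA N) := {}; B8.Prop6Printed 4 (F.L : ℝ) B₁ c₁ (fun i : B8LeafModelZd.ZdIdx 4 F.L => zdCub (MatA N) F.L i)) {M : ℕ} (hM : 1 ≤ M) :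
    (F.L : ℝ) * M ≤ 26 * b9Of F M B₁ :=
  L_mul_le_of_gauge152OfClassTopStepR hN hM (a0Of_pos (F := F) (N := N) M hB₁ hc₁) (gauge152R_of_prop6 hB₁ hc₁ hP6 M)

/-- **★★ [6] PROP. 6 AT NODE 00's MEMBER FORCES `0 < B₁`** (`0 ≤ B₁`, `0 < c₁`, `N ≥ 2`): at `M = 3` the floor reads `3L ≤ 26·(112·L⁵·B₁·(4L + 44) + 1)`, impossible at `B₁ = 0` since `L ≥ 13`.
Plan V14 stub 2 `Prop6MemberB8At F := ∃ B₁ c₁, 0 ≤ B₁ ∧ 0 < c₁ ∧ B8.Prop6Printed …` therefore has no witness with `B₁ = 0` (print: «positive constants»; n05-e's road: `B₁ = 5dLB₀ ≥ 2`).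
[cite: Balaban1985RegularSpaces, Prop. 6 p.99 (bookkeeping floor); Balaban1985Variational, (152) p.301] -/
theorem pos_of_prop6Member (hN : 2 ≤ N) {B₁ c₁ : ℝ} (hB₁ : 0 ≤ B₁) (hc₁ : 0 < c₁)
    (hP6 : letI : CStarAlgebra (MatA N) := {}; B8.Prop6Printed 4 (F.L : ℝ) B₁ c₁ (fun i : B8LeafModelZd.ZdIdx 4 F.L => zdCub (MatA N) F.L i)) : 0 < B₁ := by
  have h := L_mul_le_b9Of_of_prop6Member hN hB₁ hc₁ hP6 (M := 3) (by norm_num)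
  have hL13 : 13 ≤ F.L := by obtain ⟨hodd, _⟩ := F.hL; have := F.hL11; rcases hodd with ⟨r, hr⟩; omega
  have hLR : (13 : ℝ) ≤ F.L := by exact_mod_cast hL13
  by_contra hB
  have hB0 : B₁ = 0 := le_antisymm (not_lt.mp hB) hB₁
  rw [hB0] at h
  unfold b9Of at h
  push_cast at h
  nlinarith [h, hLR]

/-- `B₁ = 0` is refuted BY VALUE for the member sentence (`0 < c₁`, `N ≥ 2`). [cite: Balaban1985RegularSpaces, Prop. 6 p.99 (bookkeeping floor)] -/
theorem not_prop6Member_zero (hN : 2 ≤ N) {c₁ : ℝ} (hc₁ : 0 < c₁) :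
    ¬ (letI : CStarAlgebra (MatA N) := {}; B8.Prop6Printed 4 (F.L : ℝ) 0 c₁ (fun i : B8LeafModelZd.ZdIdx 4 F.L => zdCub (MatA N) F.L i)) :=
  fun h => absurd (pos_of_prop6Member (F := F) hN le_rfl hc₁ h) (lt_irrefl 0)

end PropSixMember

end Summit.QuantumFields.YangMills.Theorems.K0Gauge152RFluxFloor

end
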